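import Literature.NumberTheory.EllipticCurves.BDPAnticyclotomicPAdicLFunction
import HarnessLib

/-!
# The anticyclotomic Katz `p`-adic `L`-function `𝓛_θ ∈ Λ^{ur}` of a finite-order character over an
# imaginary quadratic field: the CHARACTERISING PREDICATE `IsKatzLFunction` (Castella–Grossi–Lee–
# Skinner 2022, Thm. 2.1.2 = Kriz 2016, Thm. 27 / Katz 1978 / Hida–Tilouine 1993), written over
# the SAME character class and evaluation points as the tree's BDP frame `IsBDPLFunction`

Cell `bsd-eis` (FULL-BSD rank ≤ 1 programme, home `run/shared/lean/pub/bsd-eis/`), seat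
`bsd-eis-lit` gen 15: item D4 of LIT-DOSSIER §35/§36 (the planner's D-0074 spec row E (i): "the
Katz-frame / BDP `p`-adic `L`-function predicate for the good lattice"). DEFINITIONS ONLY — a
characterising predicate and its complex interpolation value, in the exact pattern of
`IsBDPLFunction` / `bdpInterpolationValue` (same file conventions: `ι : ℚ̄_p ≃ ℂ`, `v` the prime of
`K` above `p` singled out by `ι`, `κ` the anticyclotomic `ℤ_p`-extension, `γ` a topological
generator, period BINDERS `Ω_K ∈ ℂ`, `Ω_p ∈ ℂ_p`, receptacle `UnrSeries p = R₀⟦T⟧`); NO named fact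
(existence — Katz/Hida–Tilouine — and the congruence CGLS Thm. 2.2.1 are statements for the typer
seat, D-0026), no `sorry`.

## The printed statement (Castella–Grossi–Lee–Skinner, Invent. Math. 227 (2022), Thm. 2.1.2;
## arXiv:2008.02571v2 TeX L1015–1041, verbatim)

"Let `θ : G_ℚ → ℤ_p^×` be a Dirichlet character of conductor `C`. As it will suffice for our
purposes, we assume that `C ∣ N` (so `p ∤ C`), and let `𝔠 ∣ 𝔑` be such that `𝓞_K/𝔠 = ℤ/Cℤ`. The
next result follows from the work of Katz [Katz78], as extended by Hida–Tilouine [HT93].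
THEOREM 2.1.2. There exists an element `𝓛_θ ∈ Λ^{ur}` characterized by the following interpolation
property: For every character `ξ` of `Γ` crystalline at both `v` and `v̄` and corresponding to a
Hecke character of `K` of infinity type `(n, -n)` with `n ∈ ℤ_{>0}` and `n ≡ 0 (mod p - 1)`, we have
`𝓛_θ(ξ) = (Ω_p^{2n}/Ω_∞^{2n}) · 4Γ(n+1) · ((2πi)^{n-1}/√D_K^{n-1}) · (1 - θ^{-1}(p) ξ^{-1}(v))
 · (1 - θ(p) ξ(v̄) p^{-1}) × ∏_{ℓ ∣ C} (1 - θ(ℓ) ξ(w) ℓ^{-1}) · L(θ_K ξ 𝐍_K, 0)`,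
where `Ω_p` and `Ω_∞` are as in Theorem 2.1.1, and for each `ℓ ∣ C` we take the prime `w ∣ ℓ` with
`w ∣ 𝔠`." Proof (L1034–1040): "`𝓛_θ` is obtained by applying `π_θ` [`g ↦ θ(g)[g]`] to the Katz
`p`-adic `L`-function described in [Kri16, Thm. 27], setting `χ^{-1} = θ_K ξ 𝐍_K`."
Kriz, Algebra Number Theory 10 (2016), Thm. 27 (arXiv:1512.05032 p. 18, verbatim; Gross's
normalisation): "`L_p(χ, 0) = 4 · Local_𝔭(χ) · (-1)^{k₁+k₂} · (Ω_p/Ω_∞)^{k₁-k₂} · (2πi/√D_K)^{-k₂} ·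
(k₁ - 1)! · (1 - χ(𝔭̄))(1 - χ̌(𝔭̄)) · L(χ, 0) · ∏_{v ∣ 𝔆}(1 - χ(v))` for characters `χ` with infinity
type `(-k₁, -k₂)` where `k₁ ≥ 1` and `k₂ ≤ 0` … (`Local_𝔭(χ) = 1` if `χ` is unramified at `𝔭`)" —
at `χ^{-1} = θ_K ξ 𝐍_K`, `k₁ = n + 1`, `k₂ = 1 - n`, reproducing CGLS's constants exactly
(`(k₁-1)! = Γ(n+1)`, `(Ω_p/Ω_∞)^{k₁-k₂} = (Ω_p/Ω_∞)^{2n}`, `(2πi/√D_K)^{-k₂} = (2πi/√D_K)^{n-1}`,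
`(-1)^{k₁+k₂} = 1`; LIT-DOSSIER §36 (C)).

## The character class: the SAME as `IsBDPLFunction` (LIT-DOSSIER §36 (C′), the "matching rule")

CGLS Thm. 2.1.1 writes the BDP interpolation with the `p`-Euler factor AT `v̄` in `ξ`
("`(1 - a_p ξ(v̄)p^{-1} + ξ(v̄)²p^{-1})²`", TeX L959–966) for `ξ` of CGLS-type `(n, -n)`; the tree's
`IsBDPLFunction` (Castella 2018, Thm. 3.1) has the same factor AT `𝔭 = v` in `φ` for `φ` of tree-type
`HasInfinityType (n) (-n)` ("Castella–Hsieh `(-n, n)`"). The one dictionary making `ξ(v̄) = φ(v)`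
hold identically is `ξ = φ^c = φ^{-1}` (anticyclotomic: `φ^c(ϖ_v) = φ(ϖ_v̄)`), consistent with the
opposite nominal infinity types; absolute sign conventions (Kriz vs CGLS vs Castella–Hsieh "differ by
a sign", Keller–Yin arXiv:2402.12781v2 L1417) are thereby NOT needed. Reading Thm. 2.1.2 through
`ξ := φ^c`: `ξ^{-1}(v) = φ(v̄)^{-1}`… precisely `ξ(v) = φ(v̄)`, `ξ(v̄) = φ(v)`, `ξ(w) = φ(w̄)`, and
`L(θ_K ξ 𝐍_K, 0) = L(θ_K φ 𝐍_K, 0)` (`θ_K = θ ∘ Nm`, `𝐍_K` are `c`-invariant and `L(χ^c, s) = L(χ, s)`)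
`= L(θ_K φ, 1)` — the value of the (entire) `L`-function of the UNITARY character `θ_K φ` at
`s = 1`: `𝐍_K` is the ADÈLIC norm character (Kriz 2016 §1 "Notation": "`𝐍_K := 𝐍_ℚ ∘ Nm_{K/ℚ}` … an
algebraic Hecke character of infinity type `(-1, -1)`"), whose value on (an idèle generating) the
ideal `𝔞` is `N𝔞^{-1}`, so `L(χ𝐍_K, s) = Σ χ(𝔞)N𝔞^{-1-s} = L(χ, s + 1)` — see the ERRATUM below;
`θ_K φ` has unitary finite part and non-trivial infinity type, hence an ENTIRE `L`-function — value
read through the tree's `LFunction.HasEntireContinuation.continuation`). The frame is evaluated at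
`T = φ̂(γ) - 1` exactly
as `IsBDPLFunction`, so that CGLS's congruence (Thm. 2.2.1) between `𝓛_E` and `𝓛_θ` as functions of
`ξ` becomes a congruence between an `IsBDPLFunction`-witness and an `IsKatzLFunction`-witness at
the same points — UP TO NORMALISATION: the tree's BDP frame carries Castella's constants
(`π^{2n+1}`), CGLS's `𝓛_E` carries `4(2π)^{2n+1}√D_K^{2n-1}/ξ(𝔑^{-1})`; a typed version of
Thm. 2.2.1 must account for this (LIT-DOSSIER §36 (C′): state it in `μ/λ` currency, CGLS Thm. 2.2.2,
or against a CGLS-normalised BDP twin). Nothing about Thm. 2.2.1 is defined or asserted here.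

## Transcription choices (each a parameter or the tree's established device)

* `θ` ↦ its restriction `θ_K` as a finite-order `HeckeCharacter K` (`θK`, PRIMARY datum; the
  Galois character `G_ℚ → ℤ_p^×` and the identity `θ_K = θ ∘ Nm` are the consumer's business):
  `θ(p) = θ_K(ϖ_v)` (`= θ_K(ϖ_v̄)`, `p ∤ C`) ↦ `heckeValueExtZero θK v`; `θ(ℓ)` for `ℓ ∣ C` is the
  Dirichlet value, `= 0` for `ℓ` dividing the conductor ↦ `heckeValueExtZero θK u` at the place
  `u` over `ℓ` (`= 0` when `θ_K` is ramified at `u`, Kriz's "`(1 - χ(v))`" convention), so for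
  `C = cond θ` exact every such factor is `1` (`katzAwayFactor_eq_one_of_forall_not_isUnramifiedAt`).
* "`w ∣ 𝔠`" read through `ξ = φ^c` becomes `φ(w̄)`: the finite set of places
  `Cbar = {w̄ : w ∣ 𝔠}` (the primes above `ℓ ∣ C` dividing `𝔠̄`) is a PARAMETER, like `𝔭` in
  `IsBDPLFunction`; `ℓ = N w̄ = u.residueCard`.
* "crystalline at `v` and `v̄`" for a character of `Γ` (unramified outside `p`) ↦ `φ` unramified at
  every finite place, as in `IsBDPLFunction`; "`n ≡ 0 (mod p - 1)`" ↦ `(p - 1) ∣ n`.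
* `√D_K` ↦ the principal square root `(D_K : ℂ)^{1/2} = i√|D_K|` (`D_K < 0`); with `n` even
  (`p` odd, `p - 1 ∣ n`) the other branch changes `𝓛_θ` by the GLOBAL sign `(-1)^{n-1} = -1`,
  immaterial for ideals, `μ`, `λ` — recorded, not hidden.
* `(Ω_p^{2n}/Ω_∞^{2n})` ↦ the complex value is divided by `Ω_K^{2n}` and the `p`-adic value
  multiplied by `Ω_p^{2n}` (`IsBDPLFunction`'s device with `4n ↦ 2n`); the SAME binders
  `(ΩK, Ωp)` must be fed to both frames (CGLS: "`Ω_p` and `Ω_∞` are as in Theorem 2.1.1").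
* `L(θ_K φ, 1)` ↦ `hL.continuation 1` for a BINDER
  `hL : LFunction.HasEntireContinuation (heckeLFunction (θK * φ))` (the tree's Euler product
  `heckeLFunction χ s = ∏ (1 - χ(ϖ_w) N w^{-s})^{-1}`, genuine on `re s > 1`, HeckeCharacter.lean — the
  point `s = 1` lies on the boundary of convergence, so the value is read through the continuation;
  its entire continuation is the named fact `heckeLFunction_hasEntireContinuation_of_not_isNormTwist`;
  `continuation` is unique by the identity theorem, so the binder's choice is immaterial).

## ERRATUM (2026-08-26, cell `bsd-eis`, seat `bsd-eis-k5-ty` g2): the interpolated `L`-value is at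
## `s = 1`, not at `s = -1` — ONE token of `IsKatzLFunction` corrected, nothing else changed

The first version of this file (p415953) read "`L(θ_K ξ 𝐍_K, 0)`" with the IDEAL norm
(`(χ𝐍_K)(𝔞) = χ(𝔞)·N𝔞`, whence "`= L(θ_K φ, -1)`") and fed `hL.continuation (-1)` to the predicate.
Kriz's `𝐍_K` — whose Thm. 27 the display of CGLS Thm. 2.1.2 transcribes ("following the notations in
op. cit.", CGLS §2.2) — is the ADÈLIC norm (Kriz, arXiv:1512.05032 §1, store text p0003 L25:
"`𝐍_K := 𝐍_ℚ ∘ Nm_{K/ℚ}` … an algebraic Hecke character of infinity type `(-1,-1)`"), with value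
`N𝔞^{-1}` on the ideal `𝔞`, so the printed value is `L(θ_K ξ, 1)` = (through `ξ = φ^c`,
`c`-invariance and `θ_K^c = θ_K`) `L(θ_K φ, 1)`. Independent confirmations, each sufficient on its own:
(E2/E3) de Shalit, *Iwasawa theory of elliptic curves with complex multiplication* (1987), II.1.1
("`χ` has infinity type `(k, j)` if `χ((a)) = a^k ā^j`"), II.4.14 (36) and II.(50): the Katz measure
interpolates `L_{∞,𝔣}(ε, 0)` for `ε` of type `(k, j)` with `0 ≤ j < -k`, with `Γ_ε(0) = Γ(-k)(2π)^k`
(II.1.1 (1)) and the factor `(2π/√d_K)^j`; CGLS's own constants `Γ(n+1)` and `((2πi)/√D_K)^{n-1}`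
therefore force `-k = n + 1`, `j = n - 1`, i.e. `ε((α)) = θ(α)·α^{-(n+1)} ᾱ^{n-1} = θ_K · ξ · N^{-1}`
with `ξ((α)) = (ᾱ/α)^n` UNITARY, and `L(ε, 0) = Σ θξ(𝔞) N𝔞^{-1-s}|_{s=0} = L(θ_K ξ, 1)` (these are
Kriz's `(k₁, k₂) = (n+1, 1-n)` of LIT-DOSSIER §36 (C) — the same numbers, the norm read adèlically);
(E4) Kriz, proof of his Cor. (store p0028): `L_p(ψ_{/K} 𝐍_K^{k/2}, 0)` equals a product of two
Kubota–Leopoldt values at `s = k/2` and `s = 1 - k/2` (Gross's factorisation) — the `ℚ`-restriction of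
the Katz value sits at `s = +k/2`, impossible with `𝐍_K(𝔞) = N𝔞`; (E5) central criticality of
`L(f, χ^{-1}, 0)` for `χ` of Kriz-type `(k+j, -j)` (BDP Thm. 5.13 = Kriz Thm. 25) forces
`|χ^{-1}(𝔞)| = N𝔞^{-k/2}`, the same ideal rule; (E6) CGLS (2.14) (proof of Thm. 2.2.1):
`𝓛_G(ξ) ∝ L(φ_K ξ 𝐍_K, 0) = L(φ_K ξ, 1)`, the weight-2 Eisenstein factor `L(φ, s)` of
`L(E₂^{φ,φ⁻¹} × ξ, s) = L(φ_K ξ, s)·L(φ_K^{-1} ξ, s - 1)` at the centre `s = 1` (with `N𝔞^{+1}` one would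
get `L(φ_K ξ, -1)`, matching neither factor). The `p`-Euler factors, the away factors, `Γ(n+1)`,
`((2πi)/√D_K)^{n-1}`, `4` and the period device were re-verified against de Shalit II.(50) (its
`(1 - ε^{-1}(𝔭)/p)` is `(1 - θ(p)^{-1} φ(v))` `=` the frame's `(1 - θ(p)^{-1} φ(v̄)^{-1})` for
anticyclotomic `φ`; the removed `𝔭̄`-factor is `(1 - θ(p) φ(v) p^{-1})`) and are UNCHANGED. `s = -1`
is also a critical point of `L(θ_K φ, s)` when `n ≥ 2`, but a different one: with the printed constants
no Katz `𝓛_θ` satisfies the old predicate, so every statement quantifying over it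
(`KellerYin2024.thm222_anacong_goodLattice_{of_ne_one,OPEN}`, the cell's `X1/KellerYinMuLambdaSplit`
shapes) was hollow and the displayed existence input `KatzLFunctionExistsFor` unsatisfiable. The
correction changes NO signature: every importer recompiles unchanged and now says what is printed.

## References

* [CastellaGrossiLeeSkinner2022] Thm. 2.1.2 (TeX L1015–1041), Thm. 2.1.1 (L959–966), §2.1 conventions (L940–947).
* [Kriz2016] Thm. 27 (arXiv:1512.05032 p. 18), §1 Notation (p. 3: `𝐍_K`, infinity types), proof of the Cor. to the main theorem (p. 28: Gross's factorisation).
* [deShalit1987] II.1.1 (infinity type, `Γ_χ`), II.4.14 (36), II.(50) (the interpolation range and value) — ERRATUM evidence.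
* [Katz1978], [HidaTilouine1993] (the constructions; cited through CGLS/Kriz).
* [KellerYin2024] §2.1.2 Thm. (TeX L1407–1419: the same statement for weight `k`), L1417 (sign warning).
* [Castella2018] Thm. 3.1; [CastellaHsieh2018] §2.5 (periods), §3.3 — via `IsBDPLFunction`.
-/

noncomputable section

open scoped MatrixGroups Topology
open NumberField IsDedekindDomain Field Polynomial
open Literature.NumberTheory.GaloisRepresentations

namespace Literature.NumberTheory.EllipticCurves.CastellaGrossiLeeSkinner2022

universe u

variable {K : Type u} [Field K] [NumberField K]

/-! ## The Euler-type factors and the complex interpolation value -/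

/-- The **away-from-`p` factor `∏_{ℓ ∣ C}(1 - θ(ℓ) ξ(w) ℓ⁻¹)`** of CGLS Thm. 2.1.2, read through
`ξ = φ^c` at the conjugate places `u = w̄ ∈ Cbar` (`ℓ = N u`), with Kriz's extended-by-zero
convention for the character values (`heckeValueExtZero`).
[cite: CastellaGrossiLeeSkinner2022, Thm. 2.1.2] [cite: Kriz2016, Thm. 27 (the factor `∏_{v∣𝔆}(1 - χ(v))`)] -/
def katzAwayFactor (θK φ : HeckeCharacter K) (Cbar : Finset (HeightOneSpectrum (𝓞 K))) : ℂ :=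
  ∏ u ∈ Cbar, (1 - heckeValueExtZero θK u * heckeValueExtZero φ u * ((u.residueCard : ℂ))⁻¹)

/-- For `C = cond θ` exact (`θ_K` ramified at every `u ∈ Cbar`) the away factor is `1` — the
extended-by-zero reading of "`θ(ℓ)`, `ℓ ∣ C`". [cite: Kriz2016, Thm. 27] -/
theorem katzAwayFactor_eq_one_of_forall_not_isUnramifiedAt {θK : HeckeCharacter K}
    (φ : HeckeCharacter K) {Cbar : Finset (HeightOneSpectrum (𝓞 K))}
    (h : ∀ u ∈ Cbar, ¬ θK.IsUnramifiedAt u) : katzAwayFactor θK φ Cbar = 1 := by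
  refine Finset.prod_eq_one fun u hu ↦ ?_
  rw [heckeValueExtZero_of_not_isUnramifiedAt (h u hu)]
  ring

/-- **The complex part of the Katz interpolation value** (CGLS Thm. 2.1.2 read through `ξ = φ^c`,
see the module docstring): `4 Γ(n+1) · ((2πi)/√D_K)^{n-1} · (1 - θ(p)⁻¹ φ(v̄)⁻¹) ·
(1 - θ(p) φ(v) p⁻¹) · katzAwayFactor · L(θ_K φ, 1) / Ω_K^{2n}`, where `θ(p) = θ_K(ϖ_v)`
(`heckeValueExtZero θK v`), `√D_K = (D_K : ℂ)^{1/2}` (principal branch), and the `L`-value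
`Lval = L(θ_K φ, 1) = L(θ_K ξ 𝐍_K, 0)` (`𝐍_K` the adèlic norm, `N𝔞^{-1}` on ideals — module docstring,
ERRATUM) is supplied by the caller (in `IsKatzLFunction`: the entire continuation of the tree's
`heckeLFunction (θK * φ)` at `s = 1`). The full printed value is this times `Ω_p^{2n}`.
[cite: CastellaGrossiLeeSkinner2022, Thm. 2.1.2 (arXiv:2008.02571v2 TeX L1021–1032)]
[cite: Kriz2016, Thm. 27, §1 Notation (`𝐍_K` of infinity type `(-1,-1)`)]
[cite: deShalit1987, II.1.1 and II.4.14 (36), (50) (interpolation range and value)] -/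
def katzInterpolationValue (p : ℕ) (θK : HeckeCharacter K) (v vbar : HeightOneSpectrum (𝓞 K))
    (Cbar : Finset (HeightOneSpectrum (𝓞 K))) (φ : HeckeCharacter K) (n : ℕ) (ΩK Lval : ℂ) : ℂ :=
  4 * Complex.Gamma (n + 1) *
    ((2 * (Real.pi : ℂ) * Complex.I) / ((NumberField.discr K : ℂ) ^ ((2 : ℂ)⁻¹))) ^ (n - 1) *
    (1 - (heckeValueExtZero θK v)⁻¹ * (heckeValueExtZero φ vbar)⁻¹) *
    (1 - heckeValueExtZero θK v * heckeValueExtZero φ v * ((p : ℂ))⁻¹) *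
    katzAwayFactor θK φ Cbar * Lval / ΩK ^ (2 * n)

variable {p : ℕ} [Fact p.Prime]

/-- **The interpolation property of the anticyclotomic Katz `p`-adic `L`-function `𝓛_θ ∈ Λ^{ur}`
(Castella–Grossi–Lee–Skinner 2022, Thm. 2.1.2; Kriz 2016, Thm. 27; Katz 1978 / Hida–Tilouine 1993)**,
as a characterising PREDICATE on `L ∈ R₀⟦T⟧` over the SAME character class and evaluation points as
`IsBDPLFunction`: for every Hecke character `φ` of `K` UNRAMIFIED at all finite places, of infinity
type `HasInfinityType (n) (-n)` with `n > 0` and `p - 1 ∣ n`, every entire continuation `hL` of the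
tree's `L(θ_K φ, s)` (a binder; unique value), and every `p`-adic avatar `r` of `φ` factoring
through `Γ` (`IsPAdicAvatarOf ι φ r`, `FactorsThroughZp κ r`), the value of `L` at `T = φ̂(γ) - 1` is
`ι⁻¹(katzInterpolationValue p θK v v̄ Cbar φ n Ω_K (L(θ_K φ, 1))) · Ω_p^{2n}` — CGLS's display with
`ξ := φ^c` (module docstring: `ξ(v) = φ(v̄)`, `ξ(v̄) = φ(v)`, `ξ(w) = φ(w̄)`,
`L(θ_K ξ 𝐍_K, 0) = L(θ_K φ, 1)`, `𝐍_K` the adèlic norm — ERRATUM in the module docstring: the first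
version evaluated at `s = -1`). Parameters: `ι : ℚ̄_p ≃ ℂ`; `v` (meant: the prime above `p`
induced by `ι⁻¹`) and `v̄` (meant: the other one, `p = v v̄`); `Cbar` (meant: `{w̄ : w ∣ 𝔠}`,
`𝓞_K/𝔠 = ℤ/Cℤ`, `C = cond θ ∣ N`); `κ`, `γ`; `θK` (meant: `θ_K = θ ∘ Nm_{K/ℚ}` for a Dirichlet
character `θ : G_ℚ → ℤ_p^×` with `p ∤ C`); `Ω_K ∈ ℂ`, `Ω_p ∈ ℂ_p` (meant: the CM period pair of
Thm. 2.1.1 — feed THE SAME binders to `IsBDPLFunction`). A predicate, not a construction and not an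
existence claim. [cite: CastellaGrossiLeeSkinner2022, Thm. 2.1.2 (arXiv:2008.02571v2 TeX L1015–1041)]
[cite: Kriz2016, Thm. 27, §1 Notation] [cite: deShalit1987, II.1.1, II.4.14 (36), (50)]
[cite: KellerYin2024, §2.1.2 (arXiv:2402.12781v2 TeX L1407–1419)] -/
def IsKatzLFunction (ι : PadicAlgCl p ≃+* ℂ) (v vbar : HeightOneSpectrum (𝓞 K))
    (Cbar : Finset (HeightOneSpectrum (𝓞 K))) (κ : ZpExtension K p) (γ : absoluteGaloisGroup K)
    (θK : HeckeCharacter K) (ΩK : ℂ) (Ωp : ℂ_[p]) (L : UnrSeries p) : Prop :=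
  ∀ (φ : HeckeCharacter K) (n : ℕ), 0 < n → (p - 1) ∣ n →
    (∀ w : HeightOneSpectrum (𝓞 K), φ.IsUnramifiedAt w) →
    φ.HasInfinityType (fun _ ↦ (n : ℤ)) (fun _ ↦ -(n : ℤ)) →
    ∀ (hL : LFunction.HasEntireContinuation (heckeLFunction (θK * φ))),
    ∀ r : FramedGaloisRep K (PadicAlgCl p) 1, IsPAdicAvatarOf ι φ r → FactorsThroughZp κ r →
      L.HasValueAt (avatarValueAt r γ - 1)
        (((ι.symm (katzInterpolationValue p θK v vbar Cbar φ n ΩK (hL.continuation 1)) :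
            PadicAlgCl p) : ℂ_[p]) * Ωp ^ (2 * n))

end Literature.NumberTheory.EllipticCurves.CastellaGrossiLeeSkinner2022

end
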